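import Summits.Ventures.PercRepro.S2SixteenNineScaled

/-!
# PercRepro — S2: THE CELL `(16, 9)` OF THE `q = 5` WINDOW BY THE NESTED DICHOTOMY WITH THE DOUBLE COLOOP SPLIT (p7, gen 10; sub-claim S2; the `p = 16` row)

The kit's `(16, 9)` cell reads `1.089` (coloop-free). As at `(17, 8)` in the kit, a coloop is split off (`delete_core_data`,
`weighted_of_isColoop_scaled`), twice if needed: the coloop-free `(16, 9)` on the coloop-free caps `16 / 117 / 813` by the NESTED
DICHOTOMY (`c025_sixteen_nine_cf`; gencell.py, every numeral exact), the scaled cells from S2SixteenNineScaled.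
**`ThmN.c025_core_five_sixteen_nine (M) (hR : ρ(E) = 16) (hn : |E| = 25) (hfree) : RLS M 16 5`**. Axioms: standard.
-/

open scoped Matroid

namespace PercRepro

namespace ThmN

open Set

variable {α : Type}

/-- The coloop-free caps at `(16, 9)`: `s₃ ≤ 16`, `s₄ ≤ 117` (`⌊25·99/21⌋`, the series-class averaging on `avgChain16 8`), `s₅ ≤ 813` (`⌊25·651/20⌋`) on every `e`-free core of nullity `9` on `25` points without coloops. -/
theorem caps_sixteen_nine_cf (M : Matroid α) [M.Finite]
    (hd : M.E.encard = M.eRank + ((9 : ℕ) : ℕ∞)) (hn : M.E.ncard = 16 + 9)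
    (hfree : ∀ e ∈ M.E, ∃ A ⊆ M.E \ {e}, e ∉ M.closure A ∧ e ∉ M.closure ((M.E \ {e}) \ A)) (hK : ∀ e, ¬ M.IsColoop e) :
    {C : Set α | M.IsCircuit C ∧ C.ncard = 3}.ncard ≤ 16 ∧
      {C : Set α | M.IsCircuit C ∧ C.ncard = 4}.ncard ≤ 117 ∧
        {C : Set α | M.IsCircuit C ∧ C.ncard = 5}.ncard ≤ 813 := by
  have hs3 := TriangleCap.core_ncard_triangles_le_cq3 M hfree hd
  rw [show TriangleCap.cq3 9 = 16 by decide] at hs3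
  have hcol : M.coloops = ∅ := S2.coloops_eq_empty_of_forall_not M hK
  have hm : 25 ≤ (M.E \ M.coloops).ncard := by
    rw [hcol, Set.sdiff_empty, hn]
  have hd' : M.E.encard = M.eRank + (((8 : ℕ) : ℕ∞) + 1) := by
    rw [hd]; norm_num
  have h := S1.ncard_fourCircuits_sub_div_le_of_nonColoops M hfree hd' (by norm_num) hm (B := 99)
    (fun M' _ hfree' hd'' => by
      have h := ncard_fourCircuits_le_avgChain16 8 M' hfree' hd''
      rw [show avgChain16 8 = 99 by decide] at h
      exact h)
  have hs4 : {C : Set α | M.IsCircuit C ∧ C.ncard = 4}.ncard ≤ 117 := by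
    have := S1.le_mul_div_of_sub_div_le (by norm_num : 4 < 25) h
    omega
  have hs5 := S2.ncard_fiveCircuits_le_of_no_coloop M hfree hd' hK (by omega)
  rw [hn] at hs5
  have h5 : (16 + 9) * S1.avgChain5b 8 / (16 + 9 - 5) = 813 := by
    rw [show S1.avgChain5b 8 = 651 by decide]
  rw [h5] at hs5
  exact ⟨hs3, hs4, hs5⟩

/-- **The top count at `(16, 9)` by the nested dichotomy**: `#U(16, 5) ≤ 292016` on every `e`-free core of rank `16` on `25`
points (the cases `ν = 8, …, 4` on `≤ 13, …, 9` points, then spread). -/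
theorem topCount_le_sixteen_nine_cf (M : Matroid α) [M.Finite]
    (hR : M.eRank = ((16 : ℕ) : ℕ∞)) (hn : M.E.ncard = 16 + 9)
    (hfree : ∀ e ∈ M.E, ∃ A ⊆ M.E \ {e}, e ∉ M.closure A ∧ e ∉ M.closure ((M.E \ {e}) \ A)) (hK : ∀ e, ¬ M.IsColoop e) :
    Matroid.topCount M 16 5 ≤ 292016 := by
  classical
  have hd : M.E.encard = M.eRank + ((9 : ℕ) : ℕ∞) := by
    rw [hR, ← M.ground_finite.cast_ncard_eq, hn]
    push_cast
    ring
  obtain ⟨hs3, hs4, hs5⟩ := caps_sixteen_nine_cf M hd hn hfree hK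
  have full : ∀ (k : ℕ) {W : Set α}, W ⊆ M.E → W.encard = M.eRk W + k →
      Matroid.topCount M 16 5 ≤ ∑ m ∈ Finset.Icc 5 9, ∑ j ∈ Finset.Icc (m + k - 9) m,
        W.ncard.choose j * (16 + 9 - W.ncard).choose (m - j) := by
    intro k W hW hWk
    refine (S2.topCount_le_sum_spanning M hR hd 5).trans ?_
    refine Finset.sum_le_sum (fun m _ => ?_)
    have h := S2.ncard_spanning_compl_le_of_nullity M hW hd hWk (m := m)
    rw [hn] at h
    exact h
  by_cases h8 : ∃ W ⊆ M.E, W.ncard ≤ 13 ∧ W.encard = M.eRk W + 8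
  · obtain ⟨W, hW, hWn, hWk⟩ := h8
    refine (full 8 hW hWk).trans ?_
    generalize W.ncard = w at hWn ⊢
    interval_cases w <;> decide
  by_cases h7 : ∃ W ⊆ M.E, W.ncard ≤ 12 ∧ W.encard = M.eRk W + 7
  · obtain ⟨W, hW, hWn, hWk⟩ := h7
    have hflat : ∀ X ⊆ M.E, M.eRk X ≤ 5 → X.ncard ≤ 12 := fun X hX hr => by
      have := S2.ncard_le_of_eRk_le_of_not_nullity M 8 13 (by norm_num) h8 hX (r := 5) (by norm_num) (by exact_mod_cast hr)
      omega
    have hflat' : ∀ X ⊆ M.E, M.eRk X ≤ 4 → X.ncard ≤ 10 := fun X hX hr =>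
      ncard_le_ten_of_eRk_le_four_of_free M hfree hX hr
    have hV := S2.ncard_spanning_compl_le_of_nullity M hW hd hWk (m := 5)
    have hV' : ∑ j ∈ Finset.Icc (5 + 7 - 9) 5, W.ncard.choose j * (M.E.ncard - W.ncard).choose (5 - j) ≤ 24387 := by
      rw [hn]
      generalize W.ncard = w at hWn ⊢
      interval_cases w <;> decide
    have hU := topCount_le_payment_flat M 16 9 (by norm_num) hR hn hfree 12 10 hflat hflat' (by norm_num) (by norm_num)
      16 117 813 hs3 hs4 hs5 24387 (hV.trans hV')
    norm_num [Finset.sum_range_succ, Nat.choose] at hU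
    have hUq : (Matroid.topCount M 16 5 : ℚ) ≤ 292016 := by linarith
    exact_mod_cast hUq
  by_cases h6 : ∃ W ⊆ M.E, W.ncard ≤ 11 ∧ W.encard = M.eRk W + 6
  · obtain ⟨W, hW, hWn, hWk⟩ := h6
    have hflat : ∀ X ⊆ M.E, M.eRk X ≤ 5 → X.ncard ≤ 11 := fun X hX hr => by
      have := S2.ncard_le_of_eRk_le_of_not_nullity M 7 12 (by norm_num) h7 hX (r := 5) (by norm_num) (by exact_mod_cast hr)
      omega
    have hflat' : ∀ X ⊆ M.E, M.eRk X ≤ 4 → X.ncard ≤ 10 := fun X hX hr =>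
      ncard_le_ten_of_eRk_le_four_of_free M hfree hX hr
    have hV := S2.ncard_spanning_compl_le_of_nullity M hW hd hWk (m := 5)
    have hV' : ∑ j ∈ Finset.Icc (5 + 6 - 9) 5, W.ncard.choose j * (M.E.ncard - W.ncard).choose (5 - j) ≤ 40117 := by
      rw [hn]
      generalize W.ncard = w at hWn ⊢
      interval_cases w <;> decide
    have hU := topCount_le_payment_flat M 16 9 (by norm_num) hR hn hfree 11 10 hflat hflat' (by norm_num) (by norm_num)
      16 117 813 hs3 hs4 hs5 40117 (hV.trans hV')
    norm_num [Finset.sum_range_succ, Nat.choose] at hU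
    have hUq : (Matroid.topCount M 16 5 : ℚ) ≤ 292016 := by linarith
    exact_mod_cast hUq
  by_cases h5 : ∃ W ⊆ M.E, W.ncard ≤ 10 ∧ W.encard = M.eRk W + 5
  · obtain ⟨W, hW, hWn, hWk⟩ := h5
    have hflat : ∀ X ⊆ M.E, M.eRk X ≤ 5 → X.ncard ≤ 10 := fun X hX hr => by
      have := S2.ncard_le_of_eRk_le_of_not_nullity M 6 11 (by norm_num) h6 hX (r := 5) (by norm_num) (by exact_mod_cast hr)
      omega
    have hflat' : ∀ X ⊆ M.E, M.eRk X ≤ 4 → X.ncard ≤ 9 := fun X hX hr => by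
      have := S2.ncard_le_of_eRk_le_of_not_nullity M 6 11 (by norm_num) h6 hX (r := 4) (by norm_num) (by exact_mod_cast hr)
      omega
    have hV := S2.ncard_spanning_compl_le_of_nullity M hW hd hWk (m := 5)
    have hV' : ∑ j ∈ Finset.Icc (5 + 5 - 9) 5, W.ncard.choose j * (M.E.ncard - W.ncard).choose (5 - j) ≤ 50127 := by
      rw [hn]
      generalize W.ncard = w at hWn ⊢
      interval_cases w <;> decide
    have hU := topCount_le_payment_flat M 16 9 (by norm_num) hR hn hfree 10 9 hflat hflat' (by norm_num) (by norm_num)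
      16 117 813 hs3 hs4 hs5 50127 (hV.trans hV')
    norm_num [Finset.sum_range_succ, Nat.choose] at hU
    have hUq : (Matroid.topCount M 16 5 : ℚ) ≤ 292016 := by linarith
    exact_mod_cast hUq
  by_cases h4 : ∃ W ⊆ M.E, W.ncard ≤ 9 ∧ W.encard = M.eRk W + 4
  · obtain ⟨W, hW, hWn, hWk⟩ := h4
    have hflat : ∀ X ⊆ M.E, M.eRk X ≤ 5 → X.ncard ≤ 9 := fun X hX hr => by
      have := S2.ncard_le_of_eRk_le_of_not_nullity M 5 10 (by norm_num) h5 hX (r := 5) (by norm_num) (by exact_mod_cast hr)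
      omega
    have hflat' : ∀ X ⊆ M.E, M.eRk X ≤ 4 → X.ncard ≤ 8 := fun X hX hr => by
      have := S2.ncard_le_of_eRk_le_of_not_nullity M 5 10 (by norm_num) h5 hX (r := 4) (by norm_num) (by exact_mod_cast hr)
      omega
    have hV := S2.ncard_spanning_compl_le_of_nullity M hW hd hWk (m := 5)
    have hV' : ∑ j ∈ Finset.Icc (5 + 4 - 9) 5, W.ncard.choose j * (M.E.ncard - W.ncard).choose (5 - j) ≤ 53130 := by
      rw [hn]
      generalize W.ncard = w at hWn ⊢
      interval_cases w <;> decide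
    have hU := topCount_le_payment_flat M 16 9 (by norm_num) hR hn hfree 9 8 hflat hflat' (by norm_num) (by norm_num)
      16 117 813 hs3 hs4 hs5 53130 (hV.trans hV')
    norm_num [Finset.sum_range_succ, Nat.choose] at hU
    have hUq : (Matroid.topCount M 16 5 : ℚ) ≤ 292016 := by linarith
    exact_mod_cast hUq
  · -- spread: rank-`5` sets `≤ 8`, rank-`4` sets `≤ 7`
    have hflat : ∀ X ⊆ M.E, M.eRk X ≤ 5 → X.ncard ≤ 8 := fun X hX hr => by
      have := S2.ncard_le_of_eRk_le_of_not_nullity M 4 9 (by norm_num) h4 hX (r := 5) (by norm_num) (by exact_mod_cast hr)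
      omega
    have hflat' : ∀ X ⊆ M.E, M.eRk X ≤ 4 → X.ncard ≤ 7 := fun X hX hr => by
      have := S2.ncard_le_of_eRk_le_of_not_nullity M 4 9 (by norm_num) h4 hX (r := 4) (by norm_num) (by exact_mod_cast hr)
      omega
    have hU := topCount_le_flat M 16 9 (by norm_num) hR hn hfree 8 7 hflat hflat' (by norm_num) (by norm_num)
      16 117 813 hs3 hs4 hs5
    norm_num [Finset.sum_range_succ, Nat.choose] at hU
    have hUq : (Matroid.topCount M 16 5 : ℚ) ≤ 292016 := by linarith
    exact_mod_cast hUq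

/-- The tail side of the cell `(16, 9)` on the caps `16 / 117 / 813`: `T = 4,241,099 ≤ 130·2^25/1024`. -/
theorem tail_sixteen_nine_cf :
    1024 * ((((16 + 9).choose 4 : ℚ) +
      (∑ j ∈ Finset.range 6, (Nat.choose (min 5 ((9 + 3) / 2 + 1 - 2)) j : ℚ) / (((j + 1) + 3 * (j + 1).choose 2 + 3 * (j + 1).choose 3 + 2 * (j + 1).choose 4 : ℕ) : ℚ)) *
        ((16 * (16 + 9 - 3).choose 2 + 117 * (16 + 9 - 4) + 813 : ℕ) : ℚ) +
      ((∑ j ∈ Finset.range 6, (Nat.choose 5 j : ℚ) / (((j + 1) + 3 * (j + 1).choose 2 + 3 * (j + 1).choose 3 + 2 * (j + 1).choose 4 : ℕ) : ℚ)) -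
        (∑ j ∈ Finset.range 6, (Nat.choose (min 5 ((9 + 3) / 2 + 1 - 2)) j : ℚ) / (((j + 1) + 3 * (j + 1).choose 2 + 3 * (j + 1).choose 3 + 2 * (j + 1).choose 4 : ℕ) : ℚ))) *
        ((10 : ℕ).choose 5 : ℚ)) +
      (((16 + 9).choose 3 * 2 ^ 3 + (16 + 9).choose 2 * 2 + (16 + 9) + 1 : ℕ) : ℚ) +
      (((16 + 9).choose 5 : ℚ) + (∑ j ∈ Finset.range (9), (Nat.choose (min 13 ((9 + 6) / 2 + 1 - 2)) j : ℚ) / (((j + 1) + 3 * (j + 1).choose 2 + 3 * (j + 1).choose 3 + 2 * (j + 1).choose 4 : ℕ) : ℚ)) * ((16 * (16 + 9 - 3).choose 3 + 117 * (16 + 9 - 4).choose 2 + 813 * (16 + 9 - 5) + (9 + 5).choose 6 : ℕ) : ℚ) +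
        ((∑ j ∈ Finset.range (9), (Nat.choose (min 19 (5 + 9) - 6) j : ℚ) / (((j + 1) + 3 * (j + 1).choose 2 + 3 * (j + 1).choose 3 + 2 * (j + 1).choose 4 : ℕ) : ℚ)) - (∑ j ∈ Finset.range (9), (Nat.choose (min 13 ((9 + 6) / 2 + 1 - 2)) j : ℚ) / (((j + 1) + 3 * (j + 1).choose 2 + 3 * (j + 1).choose 3 + 2 * (j + 1).choose 4 : ℕ) : ℚ))) *
        ((min 19 (5 + 9)).choose 6 : ℚ)) +
      ((∑ j ∈ Finset.range (9 + 1), (16 + 9).choose j : ℕ) : ℚ)) ≤ (130 : ℚ) * 2 ^ (16 + 9) := by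
  have hsm : (∑ j ∈ Finset.range (9), (Nat.choose (min 13 ((9 + 6) / 2 + 1 - 2)) j : ℚ) / (((j + 1) + 3 * (j + 1).choose 2 + 3 * (j + 1).choose 3 + 2 * (j + 1).choose 4 : ℕ) : ℚ)) = 414767 / 103635 := by
    norm_num [Finset.sum_range_succ, Nat.choose]
  have hsg : (∑ j ∈ Finset.range (9), (Nat.choose (min 19 (5 + 9) - 6) j : ℚ) / (((j + 1) + 3 * (j + 1).choose 2 + 3 * (j + 1).choose 3 + 2 * (j + 1).choose 4 : ℕ) : ℚ)) = 76499569 / 10215450 := by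
    norm_num [Finset.sum_range_succ, Nat.choose]
  have hs4m : (∑ j ∈ Finset.range 6, (Nat.choose (min 5 ((9 + 3) / 2 + 1 - 2)) j : ℚ) / (((j + 1) + 3 * (j + 1).choose 2 + 3 * (j + 1).choose 3 + 2 * (j + 1).choose 4 : ℕ) : ℚ)) = 12767 / 4230 := by
    norm_num [Finset.sum_range_succ, Nat.choose]
  have hs4g : (∑ j ∈ Finset.range 6, (Nat.choose 5 j : ℚ) / (((j + 1) + 3 * (j + 1).choose 2 + 3 * (j + 1).choose 3 + 2 * (j + 1).choose 4 : ℕ) : ℚ)) = 12767 / 4230 := by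
    norm_num [Finset.sum_range_succ, Nat.choose]
  rw [hsm, hsg, hs4m, hs4g]
  simp only [Finset.sum_range_succ, Finset.sum_range_zero]
  norm_num [Nat.choose]

/-- **The cell `(16, 9)`**: `RLS M 16 5` on every `e`-free core of rank `16` on `25` points (caps `16 / 117 / 813`, slack `130/1024`, `phiK 16 5 ≤ 2^21/20905`). -/
theorem c025_sixteen_nine_cf (M : Matroid α) [M.Finite]
    (hR : M.eRank = ((16 : ℕ) : ℕ∞)) (hn : M.E.ncard = 16 + 9)
    (hfree : ∀ e ∈ M.E, ∃ A ⊆ M.E \ {e}, e ∉ M.closure A ∧ e ∉ M.closure ((M.E \ {e}) \ A)) (hK : ∀ e, ¬ M.IsColoop e) :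
    RLS M 16 5 := by
  classical
  have hd : M.E.encard = M.eRank + ((9 : ℕ) : ℕ∞) := by
    rw [hR, ← M.ground_finite.cast_ncard_eq, hn]
    push_cast
    ring
  obtain ⟨hs3, hs4, hs5⟩ := caps_sixteen_nine_cf M hd hn hfree hK
  have hU := topCount_le_sixteen_nine_cf M hR hn hfree hK
  rw [RLS_iff]
  exact c025_core_five_cell_of_topCount_xqictq5g M 16 9 (by norm_num) hR hn hfree 16 117 813 hs3 hs4 hs5 292016 hU
    20905 (by norm_num) (phiK 16 5) (by rw [S2.phiK_sixteen_five]; norm_num) ⟨130, by norm_num, by norm_num [Nat.choose], tail_sixteen_nine_cf⟩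

/-- **THE CELL `(16, 9)` OF THE `q = 5` WINDOW**: `RLS M 16 5` for every finite `e`-free matroid of rank `16` on `25` points
(no coloop: the coloop-free cell; a coloop `e`: `M ＼ {e}` coloop-free — the scaled cell — or with a second coloop `f` — the
twice-scaled cell — lifted by the kit's coloop step). -/
theorem c025_core_five_sixteen_nine (M : Matroid α) [M.Finite]
    (hR : M.eRank = ((16 : ℕ) : ℕ∞)) (hn : M.E.ncard = 16 + 9)
    (hfree : ∀ e ∈ M.E, ∃ A ⊆ M.E \ {e}, e ∉ M.closure A ∧ e ∉ M.closure ((M.E \ {e}) \ A)) : RLS M 16 5 := by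
  classical
  by_cases hK : ∃ e, M.IsColoop e
  · obtain ⟨e, he⟩ := hK
    obtain ⟨hn', hR', hfree', -⟩ := delete_core_data M he (p := 15) (d := 9) (by rw [hR]) hn hfree
    set N := M ＼ {e} with hN
    have key : phiK 16 5 / 2 * (Matroid.topCount N 15 5 : ℚ) ≤ (Matroid.midCount N 15 5 : ℚ) := by
      by_cases hK' : ∃ f, N.IsColoop f
      · obtain ⟨f, hf⟩ := hK'
        obtain ⟨hn'', hR'', hfree'', -⟩ := delete_core_data N hf (p := 14) (d := 9) (by rw [hR']) hn' hfree'
        have key' := c025_fourteen_nine_std (N ＼ {f}) hR'' hn'' hfree''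
        have key'' : phiK 16 5 / 2 / 2 * (Matroid.topCount (N ＼ {f}) 14 (4 + 1) : ℚ) ≤
            (Matroid.midCount (N ＼ {f}) 14 (4 + 1) : ℚ) := by
          rw [div_div, show (2 : ℚ) * 2 = 4 by norm_num]
          exact key'
        exact weighted_of_isColoop_scaled N hf (by norm_num : 4 + 1 < 14) (by rw [hR']) (phiK 16 5 / 2) key''
      · push Not at hK'
        exact c025_fifteen_nine_cf N hR' hn' hfree' hK'
    rw [RLS_iff]
    exact weighted_of_isColoop_scaled M he (by norm_num : 4 + 1 < 15) (by rw [hR]) (phiK 16 5) key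
  · push Not at hK
    exact c025_sixteen_nine_cf M hR hn hfree hK

end ThmN

end PercRepro
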